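import Mathlib
import Summits.CriticalPhenomena.PercolationContinuityZ3.Theorems.PercNearOneGluingNoHeavyLowerTailTNKernels
import HarnessLib

/-!
# Staircase kernels and a banded Cauchy–Binet lemma

Support file for the Sahi / Conjecture-P programme of route `PercNearOneGluingNoHeavy`
(`--supports stmt-CriticalPhenomena-4575`, prover prim-l12-p5 gen 46; proof note
`prim-l12-p5/PROOF-HURWITZ-TRANSFER-g46.md` §1.3 and `prim-l12-p5/LEAN-BLUEPRINT-3_0-g46.md`).
No definitions, no named facts, no sorries.

Two closure lemmas for totally nonnegative kernels on `ℕ × ℕ` (all minors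
`det [K (r i) (c j)]` with strictly increasing `r, c` are `≥ 0`), complementing
`…LowerTailTNKernels`:

* `StairTN.stairs_minor_nonneg` — a kernel with nonnegative entries whose row `n` is supported in an
  interval `[a n, b n]` with `a n ≤ b n ≤ a (n+1)` ("staircase": consecutive rows overlap in at most one
  column) is totally nonnegative.  Every square submatrix on increasing rows/columns has at most one
  support-compatible transversal, the diagonal one, so every minor is a product of entries or zero; the
  proof is a Laplace expansion along the first column or the first row.  This covers bidiagonal-like
  kernels with zero rows, the "doubled" left factor `[B | h D]` of the copy-peeling identity, and
  generalized diagonal kernels.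
* `StairTN.mulBand_minor_nonneg` — `(n,l) ↦ Σ_{t ≤ 2n} A n t · B t l` is TN when `A` is TN with
  `A n t = 0` for `t > 2n` and `B` is TN (Cauchy–Binet; the `2n` version of
  `TNKernel.mulLower_minor_nonneg`, needed when the middle index runs over a doubled index set).
-/

namespace Summit.CriticalPhenomena.PercolationContinuityZ3.Theorems

namespace StairTN

open Finset Matrix

/-- **Staircase kernels are totally nonnegative.**  If `A ≥ 0` entrywise, row `n` of `A` vanishes
outside the interval `[a n, b n]`, and `a n ≤ b n ≤ a (n+1)` for all `n`, then every minor of `A` on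
strictly increasing rows and columns is `≥ 0`. -/
theorem stairs_minor_nonneg (A : ℕ → ℕ → ℝ) (a b : ℕ → ℕ) (hab : ∀ n, a n ≤ b n)
    (hba : ∀ n, b n ≤ a (n + 1)) (hA : ∀ n t, 0 ≤ A n t)
    (hlo : ∀ n t, t < a n → A n t = 0) (hhi : ∀ n t, b n < t → A n t = 0) :
    ∀ {k : ℕ} (r c : Fin k → ℕ), StrictMono r → StrictMono c →
      0 ≤ (Matrix.of fun i j => A (r i) (c j)).det := by
  -- `a` is monotone
  have hamono : ∀ m n, m ≤ n → a m ≤ a n := by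
    intro m n hmn
    induction n with
    | zero =>
      have : m = 0 := Nat.le_zero.mp hmn
      subst this; exact le_rfl
    | succ n ih =>
      rcases Nat.lt_or_eq_of_le hmn with h | h
      · exact le_trans (ih (Nat.lt_succ_iff.mp h)) (le_trans (hab n) (hba n))
      · subst h; exact le_rfl
  intro k
  induction k with
  | zero => intro r c _ _; simp
  | succ k ih =>
    intro r c hr hc
    set M : Matrix (Fin k.succ) (Fin k.succ) ℝ := Matrix.of fun i j => A (r i) (c j) with hM
    -- the common minor after deleting row 0 and column 0
    have hsub : M.submatrix Fin.succ Fin.succ = Matrix.of fun i j => A (r (Fin.succ i)) (c (Fin.succ j)) := by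
      ext i j; rfl
    have hr' : StrictMono (fun i : Fin k => r (Fin.succ i)) := fun x y hxy => hr (Fin.succ_lt_succ_iff.mpr hxy)
    have hc' : StrictMono (fun j : Fin k => c (Fin.succ j)) := fun x y hxy => hc (Fin.succ_lt_succ_iff.mpr hxy)
    have hIH : 0 ≤ (M.submatrix Fin.succ Fin.succ).det := by rw [hsub]; exact ih _ _ hr' hc'
    have h00 : 0 ≤ M 0 0 := by rw [hM, Matrix.of_apply]; exact hA _ _
    rcases Nat.lt_or_ge (c 0) (b (r 0)) with hcase | hcase
    · -- column 0 vanishes below row 0: Laplace along column 0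
      have hcol : ∀ i : Fin k.succ, i ≠ 0 → M i 0 = 0 := by
        intro i hi
        rw [hM, Matrix.of_apply]
        apply hlo
        have h1 : r 0 < r i := hr (Fin.pos_iff_ne_zero.mpr hi)
        have h2 : a (r 0 + 1) ≤ a (r i) := hamono _ _ h1
        have h3 := hba (r 0)
        omega
      rw [Matrix.det_succ_column_zero, Finset.sum_eq_single (0 : Fin k.succ)]
      · simp only [Fin.val_zero, pow_zero, one_mul, Fin.succAbove_zero]
        exact mul_nonneg h00 hIH
      · intro i _ hi; rw [hcol i hi]; simp
      · intro h; exact absurd (Finset.mem_univ _) h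
    · -- row 0 vanishes right of column 0: Laplace along row 0
      have hrow : ∀ j : Fin k.succ, j ≠ 0 → M 0 j = 0 := by
        intro j hj
        rw [hM, Matrix.of_apply]
        apply hhi
        have h1 : c 0 < c j := hc (Fin.pos_iff_ne_zero.mpr hj)
        omega
      rw [Matrix.det_succ_row_zero, Finset.sum_eq_single (0 : Fin k.succ)]
      · simp only [Fin.val_zero, pow_zero, one_mul, Fin.succAbove_zero]
        exact mul_nonneg h00 hIH
      · intro j _ hj; rw [hrow j hj]; simp
      · intro h; exact absurd (Finset.mem_univ _) h

/-- **Banded products (Cauchy–Binet).**  If `A` is TN with `A n t = 0` for `t > 2n` and `B` is TN,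
then `(n,l) ↦ Σ_{t ≤ 2n} A n t · B t l` is TN. -/
theorem mulBand_minor_nonneg (A B : ℕ → ℕ → ℝ)
    (hA : ∀ (k : ℕ) (r c : Fin k → ℕ), StrictMono r → StrictMono c →
      0 ≤ (Matrix.of fun i j => A (r i) (c j)).det)
    (hB : ∀ (k : ℕ) (r c : Fin k → ℕ), StrictMono r → StrictMono c →
      0 ≤ (Matrix.of fun i j => B (r i) (c j)).det)
    (hband : ∀ n j, 2 * n < j → A n j = 0)
    {k : ℕ} (r c : Fin k → ℕ) (hr : StrictMono r) (hc : StrictMono c) :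
    0 ≤ (Matrix.of fun i j => ∑ t ∈ range (2 * r i + 1), A (r i) t * B t (c j)).det := by
  cases k with
  | zero => simp
  | succ k =>
    set R : ℕ := 2 * r (Fin.last k) + 1 with hR
    have hrR : ∀ i, 2 * r i < R := fun i =>
      Nat.lt_succ_of_le (Nat.mul_le_mul_left 2 (hr.monotone (Fin.le_last i)))
    let A' : Matrix (Fin (k + 1)) (Fin R) ℝ := Matrix.of fun i t => A (r i) t
    let B' : Matrix (Fin R) (Fin (k + 1)) ℝ := Matrix.of fun t j => B t (c j)
    have hM : (Matrix.of fun i j => ∑ t ∈ range (2 * r i + 1), A (r i) t * B t (c j)) = A' * B' := by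
      ext i j
      rw [Matrix.mul_apply, Matrix.of_apply]
      have h1 : ∑ t ∈ range (2 * r i + 1), A (r i) t * B t (c j) =
          ∑ t ∈ range R, A (r i) t * B t (c j) := by
        refine Finset.sum_subset (fun t ht => ?_) (fun t _ ht => ?_)
        · rw [mem_range] at ht ⊢
          exact lt_of_lt_of_le ht (hrR i)
        · rw [mem_range, not_lt] at ht
          rw [hband (r i) t (by omega), zero_mul]
      rw [h1, ← Fin.sum_univ_eq_sum_range (fun t => A (r i) t * B t (c j)) R]
      rfl
    rw [hM, Literature.Analysis.TotalPositivity.det_mul_eq_sum_strictMono]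
    refine Finset.sum_nonneg fun t ht => ?_
    rw [mem_filter] at ht
    have htm : StrictMono (fun j => ((t j : Fin R) : ℕ)) :=
      fun a b hab => Fin.lt_def.1 (ht.2 hab)
    refine mul_nonneg ?_ ?_
    · have : A'.submatrix id t = Matrix.of fun i j => A (r i) ((t j : Fin R) : ℕ) := by
        ext i j; rfl
      rw [this]
      exact hA (k + 1) r (fun j => ((t j : Fin R) : ℕ)) hr htm
    · have : B'.submatrix t id = Matrix.of fun i j => B ((t i : Fin R) : ℕ) (c j) := by
        ext i j; rfl
      rw [this]
      exact hB (k + 1) (fun i => ((t i : Fin R) : ℕ)) c htm hc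

end StairTN

end Summit.CriticalPhenomena.PercolationContinuityZ3.Theorems
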